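/-
Copyright: statement-level skeleton of a published paper (lit-balaban cell, Phase-2 proof seat p20 gen 6). No proof claims
beyond what the kernel checks below.
-/
import Literature.MathematicalPhysics.QuantumFieldTheory.Balaban1983to89.B3Sect3EstimatesZeroTorus
import Literature.MathematicalPhysics.QuantumFieldTheory.Balaban1983to89.B3Ineq211ZeroTorus

/-!
# B3 — T. Bałaban, *(Higgs)₂,₃ quantum fields in a finite volume. III. Renormalization*, CMP **88** (1983) 411–445
[Balaban1983Higgs3], p. 436 [PDF 26], the step from (3.13) to **(3.14)**: *"If φ′ is a leg of a propagator with an index j″, whose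
second leg is localized in Δ(v″), then the last supremum in (3.13) can be estimated by O(1)(L^{j″}η)^{−d+1−α} sup_{x∈Δ(v),x′∈Δ(v′)}
exp[−δ₀(L^{j″}η)^{−1}dist(Γ_{x,x′},Δ(v″))], and the exponential factor together with another exponential factor in (3.13) give us the
estimate (the expression (3.12)) ≦ O(1)Σ_{Δ(v),Δ(v′)} sup_{x∈Δ(v)}|φ(x)|(L^{j₁}η)^{2d}(L^jη)^{−d}exp[−½δ₀(L^jη)^{−1}dist(Δ(v),Δ(v′))]
(L^{j′}η)^{−d+2}exp[−½δ₀(L^{j′}η)^{−1}dist(Δ(v),Δ(v′))]·(L^{j₁}η)^{1+α}(L^{j″}η)^{−d+1−α}exp[−½δ₀(L^{j″}η)^{−1}dist(Δ(v),Δ(v″))] (3.14)"* —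
PROVED WITH THE LEG HYPOTHESIS DISCHARGED at the zero-field TORUS MODEL INSTANCE: when the differentiated leg `φ′` IS a leg of the
propagator piece `G^η_{(j″)}` of Bałaban's scalar torus tower whose second leg sits at `x″` (`φ′(z) = G^η_{(j″)}(z,x″)·w`), the localized
Hölder bound that the landed (3.14) files take as the hypothesis `hleg` follows from (2.11) p. 426 for the torus pieces
(`B3Ineq211ZeroTorus.ineq211At_zeroTorusH`, p03 g4) — so (3.14) holds for the pieces with NO kernel and NO leg hypothesis left

statement-level skeleton of published theorems with citation tags; proofs where landed; nothing here is a claim about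
the Yang–Mills mass gap

PDF held: `paper:balaban1983-higgs-2-3-quantum-fields-finite-volume` (journal page = PDF page + 410); p. 436 [PDF 26] and (2.11) p. 426
[PDF 16] read in the OCR text (`p0026.txt`, `p0016.txt`).  Rows **B3.Eq3.11-3.17** (sub-display (3.14)) and **B3.Eq2.11** (consumer) of
`HOME/lit-balaban-r15/ROWS-B3.md` (fold owner r15, referee ref-4).  CONSUMES BY NAME, nothing re-proved: p20 g4's
`B3Ineq314Local.abs_term312_le_local` ((3.14) pointwise-local under `hleg`), p20 g5's `B3Ineq314Cubes.abs_term312_le_local_cubes` (the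
displayed cube form under `hleg`), `B3Sect3EstimatesZeroTorus.gpiece_bounds_of_le` (the (2.10)-type kernel bounds of the pieces at
any smaller rate), `B3Sect3KernelsZeroTorus.gpiece`/`d1Kernel_gpiece` (the pieces as Sect.-3 kernels), p03 g4's
`B3Ineq211ZeroTorus.zeroTorusKernelsH`/`ineq211At_zeroTorusH` ((2.11) for the torus pieces at every fixed `0 ≤ α < 1`), the distance
dictionary `B3Bound323ZeroTorus.T_eq_supDist` (p39) and `B3TorusRadialSums.supDist_le_tdist` (p20 g2).

WHAT IS PROVED, and how.
* §1 the leg as a field: `pdiff_leg` — `∂^η_μ[z ↦ G^η_{(j″)}(z,x″)w] = (∂^η_μG^η_{(j″)})(z,x″)·w` (r15's `d1Kernel`); the two torus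
  distances (`tdist ≤ d·supDist`, private).
* §2 **`leg_holder_of_ineq211`** — from `Ineq211At α δ₁ C₁` of p03's carrier: for all `μ, z, z′`,
  `‖(∂^η_μφ′)(z) − (∂^η_μφ′)(z′)‖ ≤ C₁(L^{j″}ε)^{1−d−α}‖w‖·(ε|z−z′|₁)^α·e^{−δ′(L^{j″}ε)^{−1}ε·min(|z−x″|₁,|z′−x″|₁)}` for every rate
  `0 ≤ δ′ ≤ δ₁/d` — exactly the shape `hleg` (the sup distance of (2.11) dominated by / dominating the `ℓ¹` distance of the Sect. 3 files).
* §3 **`abs_term312_le_leg_zeroTorus`** — (3.14) FOR THE PIECES WITH THE LEG DISCHARGED: for `d ≥ 1`, odd `L > 1`, `a > 0`, `m² ≥ 0`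
  and `0 ≤ α < 1` there are `δ′, C′ > 0` (functions of `d, L, a, m², α`) such that for EVERY volume `P = (d, L, m, K)`, every
  `1 ≤ k ≤ K`, all line indices `j, j′ ≤ j″` (*"they are earlier than the external lines"*), every `‖q·‖ ≤ Q‖·‖`, `|g|, |g′| ≤ 1`, every
  field `φ`, vector `w` and site `x″`:
  `|(3.12)[G^η_{(j)}(0), G^η_{(j′)}; φ, G^η_{(j″)}(·,x″)w]| ≤ C′Q²‖w‖(L^{j″}ε)^{1−d−α}(m·m^α)Σ_{x,x′}ε^{2d}‖φ(x)‖(L^jε)^{−d}e^{−½δ′ε|x−x′|₁/L^jε}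
  (L^{j′}ε)^{2−d}e^{−½δ′ε|x−x′|₁/L^{j′}ε}e^{−½δ′ε|x−x″|₁/L^{j″}ε}`, `m = min(L^jε, L^{j′}ε) = L^{j₁}ε` — the printed factors of (3.14):
  `(L^jη)^{−d}e^{…}(L^{j′}η)^{−d+2}e^{…}(L^{j₁}η)^{1+α}(L^{j″}η)^{−d+1−α}e^{−½δ₀(L^{j″}η)^{−1}dist(·,x″)}`;
  **`abs_term312_le_leg_cubes_zeroTorus`** — the same in the DISPLAYED cube-localized form (cubes `Δ(v), Δ(v′)` of side `M`, the
  third cube `Δ(v″) ∋ x″` of side `M″`, suprema of `‖φ‖` over `Δ(v)`, cube distances).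
HONEST SCOPE: zero external field (`A = B̃ = 0`, `U ≡ 1`: the parallel transport in (2.11) is `1`), the whole torus `T_ε` (scope of
`B4Thm110ZeroTorus`/`B3Ineq210ZeroTorus`/`B3Ineq211ZeroTorus`); general `d ≥ 1`; all three lines `G^η_{(j)}(0)`, `G^η_{(j′)}`,
`G^η_{(j″)}` are pieces of the SAME zero-field tower `G_k(T_ε,0)`; the second leg of `G^η_{(j″)}` is a POINT `x″` (the sum over
`x″ ∈ Δ(v″)` with the vertex function there is outside this display, as in `B3Ineq314Local`); PER-α constants with `α < 1` STRICT
(the decl of record `Ineq211At`, GAPS G-B3-11; the landed hypothesis-form (3.14) allowed `α ≤ 1`); `|·|` = `ε·Site.tdist` (`ℓ¹`);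
existential constants.  NOT claimed: `Ω ⊊ T_η`, `B̃ ≠ 0`, external legs that are genuinely external fields (they keep the printed
Hölder-norm hypothesis, `B3Ineq313Pointwise`/`B3Sect3KernelsZeroTorus.abs_term312_le_zeroTorus`).  Mathlib + the cited tree files only;
theorems only, no new definitions, no named facts; standard axioms.  Unit `lit-balaban-p20-g6` (Phase-2 proof seat p20, gen 6), HOME
`run/shared/lean/pub/lit-balaban/`, 2026-08-21.
-/

open scoped BigOperators

namespace Literature.MathematicalPhysics.QuantumFieldTheory.Balaban1983to89.B3Ineq314LegZeroTorus

open Matrix B1RG242Torus B5Ineq137Torus B3Ineq210ZeroTorus B3Ineq211ZeroTorus B3Sect3KernelsZeroTorus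
open LatticeFieldCalculus B3Sect3ScalarSelfEnergy B3Taylor310Remainder B3Ineq313Pointwise B3Ineq314Local B3Ineq314Cubes
open B3Sect3EstimatesZeroTorus B3Sect2StatementsPart2
open B3TorusRadialSums (supDist_le_tdist supDist_eq_zero_iff supDist_comm)

noncomputable section

universe u

variable {P : Params}

/-! ## §1 The leg `z ↦ G^η_{(j″)}(z,x″)·w` as a field; the two torus distances -/

section Leg

variable {W : Type u} [NormedAddCommGroup W] [InnerProductSpace ℝ W]

/-- The derivative of the leg `φ′(z) = G^η_{(j″)}(z,x″)·w` is the row-differentiated kernel times `w`: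
`(∂^η_μφ′)(z) = (∂^η_μG^η_{(j″)})(z,x″)·w` (r15's `d1Kernel`). [cite: Balaban1983Higgs3, (3.14) p.436] -/
theorem pdiff_leg (c : ℝ) (μ : Fin P.d) (G : Kernel P 0) (x'' : Site P 0) (w : W) (z : Site P 0) :
    pdiff c μ (fun z => G z x'' • w) z = d1Kernel c μ G z x'' • w := by
  simp only [pdiff, d1Kernel, ← sub_smul, smul_smul]

/-- `ℓ¹ ≤ d·ℓ^∞` on the torus: `Site.tdist x y ≤ d·supDist x y`. [folklore] -/
private theorem tdist_le_mul_supDist {j : ℕ} (x y : Site P j) : Site.tdist x y ≤ P.d * supDist x y := by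
  unfold supDist Site.tdist
  calc ∑ μ : Fin P.d, min (x μ - y μ).val (y μ - x μ).val
      ≤ ∑ _μ : Fin P.d, Finset.univ.sup (fun μ : Fin P.d => min (x μ - y μ).val (y μ - x μ).val) :=
        Finset.sum_le_sum fun μ _ => Finset.le_sup (f := fun μ => min (x μ - y μ).val (y μ - x μ).val) (Finset.mem_univ μ)
    _ = P.d * _ := by rw [Finset.sum_const, Finset.card_univ, Fintype.card_fin, smul_eq_mul]

/-- `|x−y|_T ≤ |x−y|₁` with `T = supDist` (p39's `T_eq_supDist`). [folklore] -/
private theorem T_le_tdist (x y : Site P 0) : T P 0 x y ≤ (Site.tdist x y : ℝ) := by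
  rw [B3Bound323ZeroTorus.T_eq_supDist P]
  exact_mod_cast supDist_le_tdist x y

/-- `|x−y|₁ ≤ d·|x−y|_T`. [folklore] -/
private theorem tdist_le_mul_T (x y : Site P 0) : (Site.tdist x y : ℝ) ≤ P.d * T P 0 x y := by
  rw [B3Bound323ZeroTorus.T_eq_supDist P]
  exact_mod_cast tdist_le_mul_supDist x y

/-- `x ≠ y ⇒ 0 < |x−y|_T`. [folklore] -/
private theorem T_pos_of_ne {x y : Site P 0} (h : x ≠ y) : 0 < T P 0 x y := by
  rw [B3Bound323ZeroTorus.T_eq_supDist P]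
  have : supDist x y ≠ 0 := fun h0 => h ((supDist_eq_zero_iff x y).mp h0)
  exact_mod_cast Nat.pos_of_ne_zero this

end Leg

/-! ## §2 The leg hypothesis of (3.14) from (2.11) -/

section Holder

variable {W : Type u} [NormedAddCommGroup W] [InnerProductSpace ℝ W]

/-- **The localized Hölder bound of the leg FROM (2.11)** p. 426: if the torus pieces satisfy `Ineq211At α δ₁ C₁` on p03's carrier
`zeroTorusKernelsH` (*"|x₂−x₁|^{−α}|(D^η_μG^η_{(j)})(x₂,x) − (D^η_μG^η_{(j)})(x₁,x)| ≤ O(1)(L^jη)^{−d+1−α}e^{−δ₁(L^jη)^{−1}dist({x₁,x₂},x)}"*),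
then the leg `φ′(z) = G^η_{(j″)}(z,x″)·w` obeys, for every direction `μ`, all `z, z′` and every rate `0 ≤ δ′ ≤ δ₁/d`:
`‖(∂^η_μφ′)(z) − (∂^η_μφ′)(z′)‖ ≤ C₁(L^{j″}ε)^{1−d−α}‖w‖·(ε|z−z′|₁)^α·e^{−δ′(L^{j″}ε)^{−1}ε·min(|z−x″|₁,|z′−x″|₁)}` — the hypothesis `hleg` of
`B3Ineq314Local.abs_term312_le_local` with `C₃ = C₁(L^{j″}ε)^{1−d−α}‖w‖` (*"O(1)(L^{j″}η)^{−d+1−α}"*). [cite: Balaban1983Higgs3, (2.11) p.426, (3.14) p.436] -/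
theorem leg_holder_of_ineq211 {a msq : ℝ} {k : ℕ} {α δ₁ C₁ : ℝ} (hα0 : 0 ≤ α) (hC₁ : 0 ≤ C₁)
    (h211 : (zeroTorusKernelsH P a msq k).Ineq211At α δ₁ C₁) {δ' : ℝ} (hδ'0 : 0 ≤ δ') (hδ' : δ' ≤ δ₁ / P.d)
    (j'' : ℕ) (x'' : Site P 0) (w : W) (μ : Fin P.d) (z z' : Site P 0) :
    ‖pdiff P.eps⁻¹ μ (fun z => gpiece P a msq k j'' z x'' • w) z -
        pdiff P.eps⁻¹ μ (fun z => gpiece P a msq k j'' z x'' • w) z'‖ ≤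
      (C₁ * P.spacing j'' ^ ((1 : ℝ) - (P.d : ℝ) - α) * ‖w‖) * (P.eps * Site.tdist z z') ^ α *
        Real.exp (-(δ' * (P.spacing j'')⁻¹ * (P.eps * ((min (Site.tdist z x'') (Site.tdist z' x'') : ℕ) : ℝ)))) := by
  have hε := P.eps_pos
  have hd : (0 : ℝ) < P.d := by exact_mod_cast P.hd
  have hsp := P.spacing_pos j''
  have hspow : 0 < P.spacing j'' ^ ((1 : ℝ) - (P.d : ℝ) - α) := Real.rpow_pos_of_pos hsp _
  -- the difference of the derivatives of the leg is the Hölder numerator of (2.11) times `w`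
  rw [pdiff_leg, pdiff_leg, ← sub_smul, norm_smul, Real.norm_eq_abs, d1Kernel_gpiece, d1Kernel_gpiece, ← mul_sub, abs_mul,
    abs_of_nonneg (by positivity : (0 : ℝ) ≤ (P.eps ^ P.d)⁻¹)]
  set N := (P.eps ^ P.d)⁻¹ * |(deriv P 0 P.eps μ * pieceT P a msq k j'') z x'' -
      (deriv P 0 P.eps μ * pieceT P a msq k j'') z' x''| with hN
  have hN0 : 0 ≤ N := by positivity
  by_cases hzz : z = z'
  · -- coinciding points: both sides vanish / are nonnegative
    subst hzz
    have : N = 0 := by rw [hN, sub_self, abs_zero, mul_zero]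
    rw [this, zero_mul]
    positivity
  · -- (2.11) at the pair (x₁, x₂) = (z′, z) and the point x″
    have hne : z' ≠ z := fun h => hzz h.symm
    have h := h211 j'' μ z' z x'' hne
    change (P.eps ^ P.d)⁻¹ * |(deriv P 0 P.eps μ * pieceT P a msq k j'') z x'' -
          (deriv P 0 P.eps μ * pieceT P a msq k j'') z' x''| / (P.eps * T P 0 z' z) ^ α ≤
        C₁ * P.spacing j'' ^ ((1 : ℝ) - (P.d : ℝ) - α) *
          Real.exp (-(δ₁ * (P.spacing j'')⁻¹ * (P.eps * min (T P 0 z' x'') (T P 0 z x'')))) at h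
    rw [← hN] at h
    have hTpos : 0 < P.eps * T P 0 z' z := mul_pos hε (T_pos_of_ne hne)
    have hTα : 0 < (P.eps * T P 0 z' z) ^ α := Real.rpow_pos_of_pos hTpos _
    rw [div_le_iff₀ hTα] at h
    -- the sup distance against the ℓ¹ distance
    have hdist : (P.eps * T P 0 z' z) ^ α ≤ (P.eps * (Site.tdist z z' : ℝ)) ^ α := by
      refine Real.rpow_le_rpow hTpos.le (mul_le_mul_of_nonneg_left ?_ hε.le) hα0
      rw [T_symm]; exact T_le_tdist z z'
    have hmin : (((min (Site.tdist z x'') (Site.tdist z' x'') : ℕ) : ℝ)) ≤ P.d * min (T P 0 z' x'') (T P 0 z x'') := by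
      rw [Nat.cast_min]
      rcases le_total (T P 0 z' x'') (T P 0 z x'') with hle | hle
      · rw [min_eq_left hle]
        exact (min_le_right _ _).trans (tdist_le_mul_T z' x'')
      · rw [min_eq_right hle]
        exact (min_le_left _ _).trans (tdist_le_mul_T z x'')
    have hexp : Real.exp (-(δ₁ * (P.spacing j'')⁻¹ * (P.eps * min (T P 0 z' x'') (T P 0 z x'')))) ≤
        Real.exp (-(δ' * (P.spacing j'')⁻¹ *
          (P.eps * ((min (Site.tdist z x'') (Site.tdist z' x'') : ℕ) : ℝ)))) := by
      rw [Real.exp_le_exp, neg_le_neg_iff]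
      have h1 : δ' * ((min (Site.tdist z x'') (Site.tdist z' x'') : ℕ) : ℝ) ≤
          δ₁ * min (T P 0 z' x'') (T P 0 z x'') := by
        calc δ' * ((min (Site.tdist z x'') (Site.tdist z' x'') : ℕ) : ℝ)
            ≤ (δ₁ / P.d) * (P.d * min (T P 0 z' x'') (T P 0 z x'')) :=
              mul_le_mul hδ' hmin (Nat.cast_nonneg _) (hδ'0.trans hδ')
          _ = δ₁ * min (T P 0 z' x'') (T P 0 z x'') := by field_simp
      have h2 : 0 ≤ (P.spacing j'')⁻¹ * P.eps := by positivity
      calc δ' * (P.spacing j'')⁻¹ * (P.eps * ((min (Site.tdist z x'') (Site.tdist z' x'') : ℕ) : ℝ))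
          = (P.spacing j'')⁻¹ * P.eps * (δ' * ((min (Site.tdist z x'') (Site.tdist z' x'') : ℕ) : ℝ)) := by ring
        _ ≤ (P.spacing j'')⁻¹ * P.eps * (δ₁ * min (T P 0 z' x'') (T P 0 z x'')) :=
          mul_le_mul_of_nonneg_left h1 h2
        _ = δ₁ * (P.spacing j'')⁻¹ * (P.eps * min (T P 0 z' x'') (T P 0 z x'')) := by ring
    have hw := norm_nonneg w
    calc N * ‖w‖ ≤ C₁ * P.spacing j'' ^ ((1 : ℝ) - (P.d : ℝ) - α) *
          Real.exp (-(δ₁ * (P.spacing j'')⁻¹ * (P.eps * min (T P 0 z' x'') (T P 0 z x'')))) *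
          (P.eps * T P 0 z' z) ^ α * ‖w‖ := mul_le_mul_of_nonneg_right h hw
      _ ≤ C₁ * P.spacing j'' ^ ((1 : ℝ) - (P.d : ℝ) - α) *
          Real.exp (-(δ' * (P.spacing j'')⁻¹ *
            (P.eps * ((min (Site.tdist z x'') (Site.tdist z' x'') : ℕ) : ℝ)))) *
          (P.eps * (Site.tdist z z' : ℝ)) ^ α * ‖w‖ := by
        gcongr
      _ = (C₁ * P.spacing j'' ^ ((1 : ℝ) - (P.d : ℝ) - α) * ‖w‖) * (P.eps * Site.tdist z z') ^ α *
          Real.exp (-(δ' * (P.spacing j'')⁻¹ *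
            (P.eps * ((min (Site.tdist z x'') (Site.tdist z' x'') : ℕ) : ℝ)))) := by ring

end Holder

/-! ## §3 (3.14) for the torus pieces with the leg discharged -/

section Ineq314

/-- kernel: the internal lines are earlier than the external one — `j, j′ ≤ j″` gives `max(L^jε, L^{j′}ε) ≤ L^{j″}ε` and `ε ≤ L^{j″}ε`.
[cite: Balaban1983Higgs3, (3.14) p.436] -/
theorem spacing_hyps {j j' j'' : ℕ} (hj : j ≤ j'') (hj' : j' ≤ j'') :
    max (P.spacing j) (P.spacing j') ≤ P.spacing j'' ∧ P.eps ≤ P.spacing j'' :=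
  ⟨max_le (B4Ineq116Torus.spacing_le_spacing P hj) (B4Ineq116Torus.spacing_le_spacing P hj'),
    P.spacing_zero ▸ B4Ineq116Torus.spacing_le_spacing P (Nat.zero_le _)⟩

/-- **(3.14) p. 436 FOR THE ZERO-FIELD TORUS PIECES, LEG HYPOTHESIS DISCHARGED BY (2.11)**: for `d ≥ 1`, odd `L > 1`, `a > 0`,
`m² ≥ 0` and a Hölder exponent `0 ≤ α < 1` there are `δ′, C′ > 0` (functions of `d, L, a, m², α`) such that for EVERY volume
`P = (d, L, m, K)` of Bałaban's scalar torus tower, every `1 ≤ k ≤ K`, all line indices `j, j′ ≤ j″`, every charge matrix with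
`‖qw‖ ≤ Q‖w‖`, localizations `|g|, |g′| ≤ 1`, every field `φ`, vector `w` and site `x″`, the expression (3.12) with lines
`G^η_{(j)}(0) = gpiece j`, `G^η_{(j′)} = gpiece j′` and the leg `φ′(z) = G^η_{(j″)}(z,x″)·w` satisfies
`|(3.12)| ≤ C′Q²‖w‖(L^{j″}ε)^{1−d−α}(m·m^α)Σ_{x,x′}ε^{2d}‖φ(x)‖(L^jε)^{−d}e^{−½δ′ε|x−x′|₁/L^jε}(L^{j′}ε)^{2−d}e^{−½δ′ε|x−x′|₁/L^{j′}ε}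
e^{−½δ′ε|x−x″|₁/L^{j″}ε}`, `m = min(L^jε, L^{j′}ε)` — the printed factors `(L^jη)^{−d}e^{…}(L^{j′}η)^{−d+2}e^{…}(L^{j₁}η)^{1+α}(L^{j″}η)^{−d+1−α}
e^{−½δ₀(L^{j″}η)^{−1}dist(·,Δ(v″))}` of (3.14), with NO kernel and NO leg hypothesis (`abs_term312_le_local_zeroTorus` + `leg_holder_of_ineq211`
+ `ineq211At_zeroTorusH`). [cite: Balaban1983Higgs3, (3.14) p.436] -/
theorem abs_term312_le_leg_zeroTorus (d L : ℕ) (hd : 1 ≤ d) (hL : Odd L ∧ 1 < L) {a : ℝ} (ha : 0 < a) {msq : ℝ}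
    (hmsq : 0 ≤ msq) {α : ℝ} (hα0 : 0 ≤ α) (hα1 : α < 1) :
    ∃ δ' C' : ℝ, 0 < δ' ∧ 0 < C' ∧ ∀ (P : Params), P.d = d → P.L = L →
      ∀ k : ℕ, 1 ≤ k → k ≤ P.K → ∀ (j j' j'' : ℕ), j ≤ j'' → j' ≤ j'' →
        ∀ {W : Type u} [NormedAddCommGroup W] [InnerProductSpace ℝ W] {Q : ℝ}, 0 ≤ Q →
        ∀ (q : W →ₗ[ℝ] W), (∀ w : W, ‖q w‖ ≤ Q * ‖w‖) →
        ∀ (g g' : SiteField P 0 ℝ), (∀ x, |g x| ≤ 1) → (∀ x, |g' x| ≤ 1) →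
        ∀ (φ : SiteField P 0 W) (w : W) (x'' : Site P 0),
          |term312 P.eps q (gpiece P a msq k j) (gpiece P a msq k j') g g' φ
              (fun z => gpiece P a msq k j'' z x'' • w)| ≤
            C' * Q ^ 2 * ‖w‖ * P.spacing j'' ^ ((1 : ℝ) - (P.d : ℝ) - α) *
              (min (P.spacing j) (P.spacing j') * (min (P.spacing j) (P.spacing j')) ^ α) *
              ∑ x : Site P 0, ∑ x' : Site P 0, P.eps ^ (2 * P.d) *
                (‖φ x‖ * (P.spacing j ^ (-(P.d : ℝ)) *
                    Real.exp (-(δ' / 2 * (P.spacing j)⁻¹ * (P.eps * Site.tdist x x'))))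
                  * (P.spacing j' ^ ((2 : ℝ) - (P.d : ℝ)) *
                    Real.exp (-(δ' / 2 * (P.spacing j')⁻¹ * (P.eps * Site.tdist x x'))))
                  * Real.exp (-(δ' / 2 * (P.spacing j'')⁻¹ * (P.eps * Site.tdist x x'')))) := by
  obtain ⟨δ, C, hδ, hC, H14⟩ := abs_term312_le_local_zeroTorus.{u} d L hd hL ha hmsq
  obtain ⟨δ₁, C₁, hδ₁, hC₁, H11⟩ := ineq211At_zeroTorusH d L hd hL ha hmsq hα0 hα1
  have hdpos : (0 : ℝ) < d := by exact_mod_cast hd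
  set δ' : ℝ := min δ (δ₁ / d) with hδ'def
  have hδ'0 : 0 < δ' := lt_min hδ (div_pos hδ₁ hdpos)
  have hδ'δ : δ' ≤ δ := min_le_left _ _
  refine ⟨δ', 8 * d * C * C * C₁ * Real.exp (δ' / 2) * (2 / δ' + 8 / δ' ^ 2), hδ'0, by positivity, ?_⟩
  intro P hPd hPL k hk1 hkK j j' j'' hj hj' W _ _ Q hQ q hq g g' hg hg' φ w x''
  obtain ⟨hss, hεs⟩ := spacing_hyps (P := P) hj hj'
  have hδ'1 : δ' ≤ δ₁ / P.d := by rw [hPd]; exact min_le_right _ _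
  have hC₃ : 0 ≤ C₁ * P.spacing j'' ^ ((1 : ℝ) - (P.d : ℝ) - α) * ‖w‖ := by
    have := Real.rpow_pos_of_pos (P.spacing_pos j'') ((1 : ℝ) - (P.d : ℝ) - α); positivity
  have hleg := leg_holder_of_ineq211 (W := W) hα0 hC₁.le (H11 P hPd hPL k hk1 hkK) hδ'0.le hδ'1 j'' x'' w
  have h := H14 δ' hδ'0 hδ'δ P hPd hPL k hk1 hkK j j' hα0 hα1.le hQ hC₃ hss hεs q hq g g' hg hg' φ
    (fun z => gpiece P a msq k j'' z x'' • w) x'' hleg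
  refine h.trans (le_of_eq ?_)
  have hdd : (d : ℝ) = (P.d : ℝ) := by rw [hPd]
  rw [hdd]
  ring

/-- **(3.14) in its DISPLAYED cube-localized form, leg discharged** (p. 436 *"We localize additionally the vertices in cubes Δ(v),
Δ(v′)"*, the third cube `Δ(v″) ∋ x″`; p20 g5's `B3Ineq314Cubes.abs_term312_le_local_cubes`, cubes of side `M` and `M″` lattice units):
with the constants of `abs_term312_le_leg_zeroTorus`,
`|(3.12)| ≤ C′Q²‖w‖(L^{j″}ε)^{1−d−α}(m·m^α)Σ_{Δ,Δ′}(Mε)^{2d}sup_{x∈Δ}‖φ(x)‖(L^jε)^{−d}e^{−½δ′·dist(Δ,Δ′)/L^jε}(L^{j′}ε)^{2−d}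
e^{−½δ′·dist(Δ,Δ′)/L^{j′}ε}e^{−½δ′·dist(Δ,Δ″)/L^{j″}ε}`. [cite: Balaban1983Higgs3, (3.14) p.436] -/
theorem abs_term312_le_leg_cubes_zeroTorus (d L : ℕ) (hd : 1 ≤ d) (hL : Odd L ∧ 1 < L) {a : ℝ} (ha : 0 < a) {msq : ℝ}
    (hmsq : 0 ≤ msq) {α : ℝ} (hα0 : 0 ≤ α) (hα1 : α < 1) :
    ∃ δ' C' : ℝ, 0 < δ' ∧ 0 < C' ∧ ∀ (P : Params), P.d = d → P.L = L →
      ∀ k : ℕ, 1 ≤ k → k ≤ P.K → ∀ (j j' j'' : ℕ), j ≤ j'' → j' ≤ j'' →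
        ∀ {W : Type u} [NormedAddCommGroup W] [InnerProductSpace ℝ W] {Q : ℝ}, 0 ≤ Q →
        ∀ (q : W →ₗ[ℝ] W), (∀ w : W, ‖q w‖ ≤ Q * ‖w‖) →
        ∀ (g g' : SiteField P 0 ℝ), (∀ x, |g x| ≤ 1) → (∀ x, |g' x| ≤ 1) →
        ∀ (φ : SiteField P 0 W) (w : W) (x'' : Site P 0) {M M'' : ℕ}, 0 < M →
          |term312 P.eps q (gpiece P a msq k j) (gpiece P a msq k j') g g' φ
              (fun z => gpiece P a msq k j'' z x'' • w)| ≤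
            C' * Q ^ 2 * ‖w‖ * P.spacing j'' ^ ((1 : ℝ) - (P.d : ℝ) - α) *
              (min (P.spacing j) (P.spacing j') * (min (P.spacing j) (P.spacing j')) ^ α) *
              ∑ c ∈ cubes P 0 M, ∑ c' ∈ cubes P 0 M, ((M : ℝ) * P.eps) ^ (2 * P.d) *
                (supOn (fiber M c : Finset (Site P 0)) (fun x => ‖φ x‖) *
                  ((P.spacing j ^ (-(P.d : ℝ)) *
                      Real.exp (-(δ' / 2 * (P.spacing j)⁻¹ * (P.eps * (cdist P 0 M M c c' : ℝ))))) *
                    (P.spacing j' ^ ((2 : ℝ) - (P.d : ℝ)) *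
                      Real.exp (-(δ' / 2 * (P.spacing j')⁻¹ * (P.eps * (cdist P 0 M M c c' : ℝ))))) *
                    Real.exp (-(δ' / 2 * (P.spacing j'')⁻¹ * (P.eps * (cdist P 0 M M'' c (cubeIdx M'' x'') : ℝ)))))) := by
  obtain ⟨δ, C, hδ, hC, HK⟩ := gpiece_bounds_of_le d L hd hL ha hmsq
  obtain ⟨δ₁, C₁, hδ₁, hC₁, H11⟩ := ineq211At_zeroTorusH d L hd hL ha hmsq hα0 hα1
  have hdpos : (0 : ℝ) < d := by exact_mod_cast hd
  set δ' : ℝ := min δ (δ₁ / d) with hδ'def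
  have hδ'0 : 0 < δ' := lt_min hδ (div_pos hδ₁ hdpos)
  have hδ'δ : δ' ≤ δ := min_le_left _ _
  refine ⟨δ', 8 * d * C * C * C₁ * Real.exp (δ' / 2) * (2 / δ' + 8 / δ' ^ 2), hδ'0, by positivity, ?_⟩
  intro P hPd hPL k hk1 hkK j j' j'' hj hj' W _ _ Q hQ q hq g g' hg hg' φ w x'' M M'' hM
  obtain ⟨hss, hεs⟩ := spacing_hyps (P := P) hj hj'
  have hδ'1 : δ' ≤ δ₁ / P.d := by rw [hPd]; exact min_le_right _ _
  have hC₃ : 0 ≤ C₁ * P.spacing j'' ^ ((1 : ℝ) - (P.d : ℝ) - α) * ‖w‖ := by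
    have := Real.rpow_pos_of_pos (P.spacing_pos j'') ((1 : ℝ) - (P.d : ℝ) - α); positivity
  have hleg := leg_holder_of_ineq211 (W := W) hα0 hC₁.le (H11 P hPd hPL k hk1 hkK) hδ'0.le hδ'1 j'' x'' w
  obtain ⟨hv, -, -, hmix⟩ := HK δ' hδ'0 hδ'δ P hPd hPL k hk1 hkK
  have h := abs_term312_le_local_cubes P.eps P.eps_pos hα0 hα1.le hQ hC₃ hδ'0 (P.spacing_pos j) (P.spacing_pos j') hss hεs
    q hq _ _ g g' hg hg' (fun μ x x' => hmix j μ μ x x') (hv j') φ (fun z => gpiece P a msq k j'' z x'' • w) x'' hleg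
    (M'' := M'') hM
  refine h.trans (le_of_eq ?_)
  have hdd : (d : ℝ) = (P.d : ℝ) := by rw [hPd]
  rw [hdd]
  ring

end Ineq314

end

end Literature.MathematicalPhysics.QuantumFieldTheory.Balaban1983to89.B3Ineq314LegZeroTorus
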